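import Summits.ResolutionOfSingularities.ResolutionOfSingularities.Theorems.EquisingularLiftEquisingularLiftNatResidueHypDefsE
import HarnessLib

/-!
# [OURS · L1 W4.5(b) · EL♮ / EL♮(3)] RESIDUE HYPOTHESIS DEFS E2 — door ν4 v2: `ReachEquinodalPlanarNose₂` / `NoseHypHostedNestEquinodalBTriplePrime₂`
# (= …NatResidueHypDefsE's door and blob with the END-STAGE clauses the B‴-tail supplier consumes; new module, new names — R44 pattern)

Typed by res-L1-w45b-nose-w1 g3 (pen of HSUBᵉ per desk R58 (2)) the same hour as ✓ p672893: typing HSUBᵉ against res-L1-w45b-nose-w2's HSUBʰ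
(✓ `hsubh_reachHostedNoseBTriplePrime_of_embeddedCurveLiftFact`, whose nose-round + B‴-tail core is `hsub_reachNoseTowerBTriplePrime_of_fact'`) showed
that door v1 is MISSTATED IN SCOPE for that supplier: at the reached stage `(F₂, T₂, Z₂)` it gives only «`Z̃₂` regular + `IsBlowup υ' 𝓘⟨Z₂⟩`», while the
tail supplier consumes `Z₂ ⊆ T₂`, `¬ T₂ ⊆ Z₂`, `Z₂.Infinite` and the curve clause for `Z̃₂` (all trivially TRUE for every customer — `Z₂` is the strict
transform of the nose curve — and not derivable upstairs without a fibre-dimension detour).  v2 = v1 VERBATIM plus: (i) in the inner motive's (pt) and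
(rd) clauses the binders `W ⊆ T →` (and `¬ W ⊆ Z' →` in (rd)) — the nose transform stays inside the surface transform and is not the rounded line —,
(ii) at the reached stage the four clauses above.  The blob `NoseHypHostedNestEquinodalBTriplePrime₂` is …DefsE's blob with the door name replaced
(one token); inclusions PURE: blob₂ ⇒ blob₃ᵉ v2, blob₃ᵉ v2 ⇒ blob₃ᵉ v1 (`reachEquinodalPlanarNose_of_reachEquinodalPlanarNose₂`: a v2 move is a v1
move), and the two `not_` REPLACE lemmas.  `EqCertAt₀` / `EqCertDet` / `hessBlock` / `restrictToHyperplane` / `IsCoordVecOf` are …DefsE's, unchanged.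
House style R21″ (C): definitions + pure-logic lemmas; no `sorry`, no instance, no notation; standard axioms.  OURS; NAMED HYPOTHESES, not statements of
any manuscript; nothing of [Hironaka2017] is asserted; AI-written, weaker than expert review; EL♮(3) NOT proved; resolution in positive characteristic NOT
proved (dim 3 = Cossart–Piltant 2008/2009).  `--kind definition --supports stmt-ResolutionOfSingularities-20148 --as helper`.
-/

set_option linter.dupNamespace false
noncomputable section
open CategoryTheory CategoryTheory.Limits AlgebraicGeometry TopologicalSpace Topology IsLocalRing
open Literature.AlgebraicGeometry.Resolution
open AlgebraicGeometry.Scheme.IdealSheafData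
namespace Summit.ResolutionOfSingularities.ResolutionOfSingularities.Cruxes.EquisingularLiftNat.Sections

/-- **`ReachEquinodalPlanarNose₂ k n ℓ T₁ F₉ β T₉ E₉`** — door ν4 «EQUINODAL PLANAR NOSE» v2 (= `ReachEquinodalPlanarNose` of …NatResidueHypDefsE with the
nose transform `W ⊆ T` / `W ⊄ Z'` carried through the inner motive and the END-STAGE clauses `Z₂ ⊆ T₂`, `T₂ ⊄ Z₂`, `Z₂` infinite, curve clause for `Z̃₂`
that the B‴-tail supplier `hsub_reachNoseTowerBTriplePrime_of_fact'` consumes — v1 was misstated IN SCOPE for that supplier, R44 pattern), INITIAL STAGE, host the hyperplane `Π = V₊(ℓ)` of `ℙⁿ_k`; same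
currency as `ReachHostedNoseBTriplePrime` (…NatResidueHypDefs6): the reached stage is `(F₉, β : F₉ ⟶ ℙⁿ, T₉, E₉)` with the host dropped (`E₉ = ∅`).
Template: idea-2 Sketch v3 1d7d57a44f30e82a l.77, with (i) the node predicate and the finiteness clause REPLACED by the concrete certificate
`EqCertAt₀ k n ℓ Z hZ` (marked ordinary nodes covering the non-regular points + (CERT-EQ)), (ii) the inner motive ALSO closed under the stage-level HOSTED
ROUND of …NatResidueHypDefs7 (binder list verbatim, with the nose transform `W` carried along: `W ↦ closure (υ'⁻¹(W ∖ Z'))`) — §C C1.3's delta, so that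
the lines `ℓᵢ = Eᵢ ∩ St Π` are rounded before the nose round.  See the module docstring for the move-by-move meaning and the upstairs suppliers.
[OURS · named hypothesis fragment, no mathematical content of its own] -/
def ReachEquinodalPlanarNose₂ (k : Type) [Field k] (n : ℕ) (ℓ : MvPolynomial (Fin (n + 1)) k)
    (T₁ : Set (Literature.AlgebraicGeometry.Motives.projectiveSpace n k).left) (F₉ : Scheme.{0}) (β : F₉ ⟶ (Literature.AlgebraicGeometry.Motives.projectiveSpace n k).left) (T₉ E₉ : Set F₉) : Prop :=
  letI := MvPolynomial.gradedAlgebra (σ := Fin (n + 1)) (R := k)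
  E₉ = ∅ ∧
  ∃ (Z : Set (Literature.AlgebraicGeometry.Motives.projectiveSpace n k).left) (hZ : IsClosed Z),
    Z ⊆ T₁ ∧ ¬ (T₁ ⊆ Z) ∧ Z.Infinite ∧
    Z ⊆ {y : (Literature.AlgebraicGeometry.Motives.projectiveSpace n k).left | ℓ ∈ (y : ProjectiveSpectrum (MvPolynomial.homogeneousSubmodule (Fin (n + 1)) k)).asHomogeneousIdeal} ∧
    IsPreirreducible Z ∧
    -- curve clause
    (∀ z : ↥(redSub (Literature.AlgebraicGeometry.Motives.projectiveSpace n k).left Z hZ), IsClosed ({z} : Set ↥(redSub (Literature.AlgebraicGeometry.Motives.projectiveSpace n k).left Z hZ)) →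
      ringKrullDim ((redSub (Literature.AlgebraicGeometry.Motives.projectiveSpace n k).left Z hZ).presheaf.stalk z) = ((1 : ℕ) : WithBot ℕ∞)) ∧
    -- ambient regular along `Z̃`
    (∀ (i : redSub (Literature.AlgebraicGeometry.Motives.projectiveSpace n k).left Z hZ ⟶ redSub (Literature.AlgebraicGeometry.Motives.projectiveSpace n k).left Set.univ isClosed_univ), i ≫ redSubι (Literature.AlgebraicGeometry.Motives.projectiveSpace n k).left Set.univ isClosed_univ = redSubι (Literature.AlgebraicGeometry.Motives.projectiveSpace n k).left Z hZ →
      ∀ z : ↥(redSub (Literature.AlgebraicGeometry.Motives.projectiveSpace n k).left Z hZ), IsRegularLocalRing ((redSub (Literature.AlgebraicGeometry.Motives.projectiveSpace n k).left Set.univ isClosed_univ).presheaf.stalk (i.base z))) ∧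
    -- host regular along `Z̃`
    (∀ (i : redSub (Literature.AlgebraicGeometry.Motives.projectiveSpace n k).left Z hZ ⟶ redSub (Literature.AlgebraicGeometry.Motives.projectiveSpace n k).left (closure {y : (Literature.AlgebraicGeometry.Motives.projectiveSpace n k).left | ℓ ∈ (y : ProjectiveSpectrum (MvPolynomial.homogeneousSubmodule (Fin (n + 1)) k)).asHomogeneousIdeal}) isClosed_closure),
      i ≫ redSubι (Literature.AlgebraicGeometry.Motives.projectiveSpace n k).left (closure {y : (Literature.AlgebraicGeometry.Motives.projectiveSpace n k).left | ℓ ∈ (y : ProjectiveSpectrum (MvPolynomial.homogeneousSubmodule (Fin (n + 1)) k)).asHomogeneousIdeal}) isClosed_closure = redSubι (Literature.AlgebraicGeometry.Motives.projectiveSpace n k).left Z hZ →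
      ∀ z : ↥(redSub (Literature.AlgebraicGeometry.Motives.projectiveSpace n k).left Z hZ), IsRegularLocalRing ((redSub (Literature.AlgebraicGeometry.Motives.projectiveSpace n k).left (closure {y : (Literature.AlgebraicGeometry.Motives.projectiveSpace n k).left | ℓ ∈ (y : ProjectiveSpectrum (MvPolynomial.homogeneousSubmodule (Fin (n + 1)) k)).asHomogeneousIdeal}) isClosed_closure).presheaf.stalk (i.base z))) ∧
    -- host two-dimensional along `Z` (n = 3 in effect)
    (∀ e : ↥(redSub (Literature.AlgebraicGeometry.Motives.projectiveSpace n k).left (closure {y : (Literature.AlgebraicGeometry.Motives.projectiveSpace n k).left | ℓ ∈ (y : ProjectiveSpectrum (MvPolynomial.homogeneousSubmodule (Fin (n + 1)) k)).asHomogeneousIdeal}) isClosed_closure),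
      IsClosed ({e} : Set ↥(redSub (Literature.AlgebraicGeometry.Motives.projectiveSpace n k).left (closure {y : (Literature.AlgebraicGeometry.Motives.projectiveSpace n k).left | ℓ ∈ (y : ProjectiveSpectrum (MvPolynomial.homogeneousSubmodule (Fin (n + 1)) k)).asHomogeneousIdeal}) isClosed_closure)) →
      (redSubι (Literature.AlgebraicGeometry.Motives.projectiveSpace n k).left (closure {y : (Literature.AlgebraicGeometry.Motives.projectiveSpace n k).left | ℓ ∈ (y : ProjectiveSpectrum (MvPolynomial.homogeneousSubmodule (Fin (n + 1)) k)).asHomogeneousIdeal}) isClosed_closure e : (Literature.AlgebraicGeometry.Motives.projectiveSpace n k).left) ∈ Z →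
      ringKrullDim ((redSub (Literature.AlgebraicGeometry.Motives.projectiveSpace n k).left (closure {y : (Literature.AlgebraicGeometry.Motives.projectiveSpace n k).left | ℓ ∈ (y : ProjectiveSpectrum (MvPolynomial.homogeneousSubmodule (Fin (n + 1)) k)).asHomogeneousIdeal}) isClosed_closure).presheaf.stalk e) = ((2 : ℕ) : WithBot ℕ∞)) ∧
    -- the certificate (CERT-EQ), concrete: marked ORDINARY nodes covering the non-regular points, independent conditions on degree-`e` forms
    EqCertAt₀ k n ℓ Z hZ ∧
    -- THE SUB-CHAIN: inner motive `R G γ T E W` closed under (pt) point steps at non-regular points of `W̃` and (rd) Defs7's stage-level hosted round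
    ∃ (F₂ : Scheme.{0}) (υ : F₂ ⟶ (Literature.AlgebraicGeometry.Motives.projectiveSpace n k).left) (T₂ E₂ Z₂ : Set F₂) (hZ₂ : IsClosed Z₂),
      (∀ R : (∀ G : Scheme.{0}, (G ⟶ (Literature.AlgebraicGeometry.Motives.projectiveSpace n k).left) → Set G → Set G → Set G → Prop),
        R (Literature.AlgebraicGeometry.Motives.projectiveSpace n k).left (𝟙 (Literature.AlgebraicGeometry.Motives.projectiveSpace n k).left) T₁ {y : (Literature.AlgebraicGeometry.Motives.projectiveSpace n k).left | ℓ ∈ (y : ProjectiveSpectrum (MvPolynomial.homogeneousSubmodule (Fin (n + 1)) k)).asHomogeneousIdeal} Z →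
        -- (pt) the blow-up of a NON-REGULAR closed point of the nose transform `W̃`, regular on the ambient and on the host when it lies in it
        --      (hypothesis shape = …NatResidueHypDefs7's point-step clause, with `W` carried along)
        (∀ (G G' : Scheme.{0}) (γ : G ⟶ (Literature.AlgebraicGeometry.Motives.projectiveSpace n k).left) (T E W : Set G) (hW : IsClosed W) (w : ↥(redSub G W hW)) (υ₁ : G' ⟶ G)
            (hy : IsClosed ({(redSubι G W hW w : G)} : Set G)),
          R G γ T E W → W ⊆ T → ¬ IsRegularLocalRing ((redSub G W hW).presheaf.stalk w) →
          IsRegularLocalRing (G.presheaf.stalk (redSubι G W hW w : G)) →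
          ((redSubι G W hW w : G) ∈ closure E → ∀ e : ↥(redSub G (closure E) isClosed_closure),
            (redSubι G (closure E) isClosed_closure e : G) = (redSubι G W hW w : G) →
            IsRegularLocalRing ((redSub G (closure E) isClosed_closure).presheaf.stalk e)) →
          IsBlowup υ₁ (vanishingIdeal (⟨{(redSubι G W hW w : G)}, hy⟩ : Closeds G)) →
          R G' (υ₁ ≫ γ) (closure (υ₁ ⁻¹' (T \ {(redSubι G W hW w : G)}))) (closure (υ₁ ⁻¹' (E \ {(redSubι G W hW w : G)})))
            (closure (υ₁ ⁻¹' (W \ {(redSubι G W hW w : G)})))) →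
        -- (rd) STAGE-LEVEL HOSTED ROUND at a regular curve `Z'` inside the host, unobstructed IN THE HOST (…NatResidueHypDefs7's binder list verbatim; `W` carried along)
        (∀ (G G' : Scheme.{0}) (γ : G ⟶ (Literature.AlgebraicGeometry.Motives.projectiveSpace n k).left) (T E W : Set G) (Z' : Set G) (hZ' : IsClosed Z') (υ' : G' ⟶ G),
          R G γ T E W → W ⊆ T → ¬ W ⊆ Z' → Z' ⊆ closure E → Z' ⊆ T → ¬ T ⊆ Z' → (∀ z : ↥(redSub G Z' hZ'), IsRegularLocalRing ((redSub G Z' hZ').presheaf.stalk z)) →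
          (∀ (i : redSub G Z' hZ' ⟶ redSub G (closure E) isClosed_closure), i ≫ redSubι G (closure E) isClosed_closure = redSubι G Z' hZ' →
            ∀ z : ↥(redSub G Z' hZ'), IsRegularLocalRing ((redSub G (closure E) isClosed_closure).presheaf.stalk (i z))) → DirStepUnobs G (closure E) isClosed_closure Z' hZ' →
          (∀ z : ↥(redSub G Z' hZ'), IsClosed ({z} : Set ↥(redSub G Z' hZ')) → ringKrullDim ((redSub G Z' hZ').presheaf.stalk z) = ((1 : ℕ) : WithBot ℕ∞)) →
          IsBlowup υ' (vanishingIdeal (⟨Z', hZ'⟩ : Closeds G)) →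
          R G' (υ' ≫ γ) (closure (υ' ⁻¹' (T \ Z'))) (closure (υ' ⁻¹' (closure E \ Z'))) (closure (υ' ⁻¹' (W \ Z')))) →
        R F₂ υ T₂ E₂ Z₂) ∧
      -- at the reached stage the nose transform is a REGULAR infinite curve inside the surface transform, not all of it …
      Z₂ ⊆ T₂ ∧ ¬ (T₂ ⊆ Z₂) ∧ Z₂.Infinite ∧
      (∀ z : ↥(redSub F₂ Z₂ hZ₂), IsClosed ({z} : Set ↥(redSub F₂ Z₂ hZ₂)) →
        ringKrullDim ((redSub F₂ Z₂ hZ₂).presheaf.stalk z) = ((1 : ℕ) : WithBot ℕ∞)) ∧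
      (∀ z : ↥(redSub F₂ Z₂ hZ₂), IsRegularLocalRing ((redSub F₂ Z₂ hZ₂).presheaf.stalk z)) ∧
      -- … and is blown up (NO unobstructedness clause: upstairs the centre is the GIVEN strict transform of the equinodal lift), then a B‴ tail
      ∃ (F₃ : Scheme.{0}) (υ' : F₃ ⟶ F₂), IsBlowup υ' (vanishingIdeal (⟨Z₂, hZ₂⟩ : Closeds F₂)) ∧
        ∃ (γ' : F₉ ⟶ F₃) (E' : Set F₉) (Es' Ns' : List (Set F₉)) (K' : Set F₉),
          (∀ R : (∀ G : Scheme.{0}, (G ⟶ F₃) → Set G → Set G → List (Set G) → List (Set G) → Set G → Prop),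
            R F₃ (𝟙 F₃) (closure (υ' ⁻¹' (T₂ \ Z₂))) (υ' ⁻¹' Z₂) [] [] ∅ →
            TowerPtRegB₄ F₃ R → TowerPtRamB₄ F₃ R → TowerRoundBTriplePrime F₂ F₃ υ' Z₂ hZ₂ R →
            R F₉ γ' T₉ E' Es' Ns' K') ∧
          β = (γ' ≫ υ') ≫ υ

/-- **`NoseHypHostedNestEquinodalBTriplePrime₂ k n H ι`** (blob₃ᵉ v2: the SAME text as `NoseHypHostedNestEquinodalBTriplePrime` with the door
`ReachEquinodalPlanarNose₂`; door ν4 «EQUINODAL PLANAR NOSE») — `NoseHypHostedNestBTriplePrime₂` (…NatResidueHypDefs7, ✓ p661915)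
VERBATIM (the `E₀` binder, the point-step clause, the stage-level hosted-round clause, the `ReachHostedNoseBTriplePrime` clause, the regular end), the motive `Q`
being ADDITIONALLY closed under ONE initial-stage rule: when the host is the hyperplane `E₀ = V₊(ℓ)`, `ReachEquinodalPlanarNose k n ℓ (range ι) F₉ β T₉ E₉`
transports `Q` from `(ℙⁿ, 𝟙, range ι, E₀)` to `(F₉, β, T₉, E₉)` (door v2).  More closure asked of `Q` ⇒ implied by blob₂ (`…₂_of_hostedNest₂` below, pure logic).
Rung shape (R-ν4ᵉ, lead-2 (D6-6)): the registered nose residue's binders with last hypothesis THIS blob ⊢ `ELNatConclusionO k n H ι`; the 41st =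
REPLACE `¬ NoseHypHostedNestBTriplePrime₂ ↦ ¬ NoseHypHostedNestEquinodalBTriplePrime₂`.  n-SCOPE: the door's host-dimension and curve clauses make the
extra rule fire only for n = 3 (harmless for PARENT, count-neutral).  See the module docstring.
[OURS · L1 W4.5b · named hypothesis, no mathematical content of its own] -/
def NoseHypHostedNestEquinodalBTriplePrime₂ (k : Type) [Field k] [IsAlgClosed k] (n : ℕ) (H : AlgebraicGeometry.Scheme.{0})
    (ι : H ⟶ (Literature.AlgebraicGeometry.Motives.projectiveSpace n k).left) : Prop :=
  letI := MvPolynomial.gradedAlgebra (σ := Fin (n + 1)) (R := k)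
  ∃ (E₀ : Set (Literature.AlgebraicGeometry.Motives.projectiveSpace n k).left),
    (E₀ = ∅ ∨ ∃ ℓ : MvPolynomial (Fin (n + 1)) k, ℓ.IsHomogeneous 1 ∧ ℓ ≠ 0 ∧
      ¬ (Set.range ι ⊆ {y : (Literature.AlgebraicGeometry.Motives.projectiveSpace n k).left |
        ℓ ∈ (y : ProjectiveSpectrum (MvPolynomial.homogeneousSubmodule (Fin (n + 1)) k)).asHomogeneousIdeal}) ∧
      E₀ = {y : (Literature.AlgebraicGeometry.Motives.projectiveSpace n k).left |
        ℓ ∈ (y : ProjectiveSpectrum (MvPolynomial.homogeneousSubmodule (Fin (n + 1)) k)).asHomogeneousIdeal}) ∧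
    (∃ (F' : AlgebraicGeometry.Scheme.{0}) (ρ' : F' ⟶ (Literature.AlgebraicGeometry.Motives.projectiveSpace n k).left) (T' : Set F'),
      (∀ Q : (∀ F₁ : AlgebraicGeometry.Scheme.{0}, (F₁ ⟶ (Literature.AlgebraicGeometry.Motives.projectiveSpace n k).left) → Set F₁ → Set F₁ → Prop),
        Q (Literature.AlgebraicGeometry.Motives.projectiveSpace n k).left (𝟙 (Literature.AlgebraicGeometry.Motives.projectiveSpace n k).left) (Set.range ι) E₀ →
        (∀ (F₁ F₂ : AlgebraicGeometry.Scheme.{0}) (ρ : F₁ ⟶ (Literature.AlgebraicGeometry.Motives.projectiveSpace n k).left) (T₁ E₁ : Set F₁)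
            (x : ↥((AlgebraicGeometry.Scheme.IdealSheafData.vanishingIdeal (⟨closure T₁, isClosed_closure⟩ : TopologicalSpace.Closeds F₁))).subscheme) (υ : F₂ ⟶ F₁) (hx : IsClosed ({(((AlgebraicGeometry.Scheme.IdealSheafData.vanishingIdeal (⟨closure T₁, isClosed_closure⟩ : TopologicalSpace.Closeds F₁))).subschemeι x : F₁)} : Set F₁)),
          Q F₁ ρ T₁ E₁ → ¬ IsRegularLocalRing (((AlgebraicGeometry.Scheme.IdealSheafData.vanishingIdeal (⟨closure T₁, isClosed_closure⟩ : TopologicalSpace.Closeds F₁))).subscheme.presheaf.stalk x) →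
          IsRegularLocalRing (F₁.presheaf.stalk (((AlgebraicGeometry.Scheme.IdealSheafData.vanishingIdeal (⟨closure T₁, isClosed_closure⟩ : TopologicalSpace.Closeds F₁))).subschemeι x : F₁)) →
          ((((AlgebraicGeometry.Scheme.IdealSheafData.vanishingIdeal (⟨closure T₁, isClosed_closure⟩ : TopologicalSpace.Closeds F₁))).subschemeι x : F₁) ∈ closure E₁ → ∀ e : ↥(redSub F₁ (closure E₁) isClosed_closure), (redSubι F₁ (closure E₁) isClosed_closure e : F₁) = (((AlgebraicGeometry.Scheme.IdealSheafData.vanishingIdeal (⟨closure T₁, isClosed_closure⟩ : TopologicalSpace.Closeds F₁))).subschemeι x : F₁) →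
          IsRegularLocalRing ((redSub F₁ (closure E₁) isClosed_closure).presheaf.stalk e)) → Literature.AlgebraicGeometry.Resolution.IsBlowup υ
            (AlgebraicGeometry.Scheme.IdealSheafData.vanishingIdeal (⟨{(((AlgebraicGeometry.Scheme.IdealSheafData.vanishingIdeal (⟨closure T₁, isClosed_closure⟩ : TopologicalSpace.Closeds F₁))).subschemeι x : F₁)}, hx⟩ : TopologicalSpace.Closeds F₁)) →
          Q F₂ (υ ≫ ρ) (closure (υ ⁻¹' (T₁ \ {(((AlgebraicGeometry.Scheme.IdealSheafData.vanishingIdeal (⟨closure T₁, isClosed_closure⟩ : TopologicalSpace.Closeds F₁))).subschemeι x : F₁)}))) (closure (υ ⁻¹' (E₁ \ {(((AlgebraicGeometry.Scheme.IdealSheafData.vanishingIdeal (⟨closure T₁, isClosed_closure⟩ : TopologicalSpace.Closeds F₁))).subschemeι x : F₁)})))) →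
        -- STAGE-LEVEL HOSTED ROUND at a regular curve `Z` inside the host, unobstructed IN THE HOST (in-host NEST lines and the nose curve alike)
        (∀ (F₁ F₃ : AlgebraicGeometry.Scheme.{0}) (ρ : F₁ ⟶ (Literature.AlgebraicGeometry.Motives.projectiveSpace n k).left) (T₁ E₁ : Set F₁) (Z : Set F₁) (hZ : IsClosed Z) (υ' : F₃ ⟶ F₁),
          Q F₁ ρ T₁ E₁ → Z ⊆ closure E₁ → Z ⊆ T₁ → ¬ T₁ ⊆ Z → (∀ z : ↥(redSub F₁ Z hZ), IsRegularLocalRing ((redSub F₁ Z hZ).presheaf.stalk z)) →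
          (∀ (i : redSub F₁ Z hZ ⟶ redSub F₁ (closure E₁) isClosed_closure), i ≫ redSubι F₁ (closure E₁) isClosed_closure = redSubι F₁ Z hZ →
            ∀ z : ↥(redSub F₁ Z hZ), IsRegularLocalRing ((redSub F₁ (closure E₁) isClosed_closure).presheaf.stalk (i z))) → DirStepUnobs F₁ (closure E₁) isClosed_closure Z hZ →
          (∀ z : ↥(redSub F₁ Z hZ), IsClosed ({z} : Set ↥(redSub F₁ Z hZ)) → ringKrullDim ((redSub F₁ Z hZ).presheaf.stalk z) = ((1 : ℕ) : WithBot ℕ∞)) →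
          Literature.AlgebraicGeometry.Resolution.IsBlowup υ' (AlgebraicGeometry.Scheme.IdealSheafData.vanishingIdeal (⟨Z, hZ⟩ : TopologicalSpace.Closeds F₁)) →
          Q F₃ (υ' ≫ ρ) (closure (υ' ⁻¹' (T₁ \ Z))) (closure (υ' ⁻¹' (closure E₁ \ Z)))) →
        (∀ (F₁ : AlgebraicGeometry.Scheme.{0}) (ρ : F₁ ⟶ (Literature.AlgebraicGeometry.Motives.projectiveSpace n k).left) (T₁ E₁ : Set F₁) (F₉ : AlgebraicGeometry.Scheme.{0}) (β : F₉ ⟶ F₁) (T₉ E₉ : Set F₉),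
          Q F₁ ρ T₁ E₁ → ReachHostedNoseBTriplePrime F₁ T₁ E₁ F₉ β T₉ E₉ → Q F₉ (β ≫ ρ) T₉ E₉) →
        -- INITIAL-STAGE EQUINODAL PLANAR NOSE inside the hyperplane host `E₀ = V₊(ℓ)` (door `ReachEquinodalPlanarNose`, certificate (CERT-EQ) concrete = `EqCertAt₀`):
        -- the sub-chain blows up the marked nodes itself, rounds the in-host lines, then the nose round on the transform and a B‴ tail; unavailable when `E₀ = ∅`
        (∀ (ℓ : MvPolynomial (Fin (n + 1)) k) (F₉ : AlgebraicGeometry.Scheme.{0}) (β : F₉ ⟶ (Literature.AlgebraicGeometry.Motives.projectiveSpace n k).left) (T₉ E₉ : Set F₉),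
          Q (Literature.AlgebraicGeometry.Motives.projectiveSpace n k).left (𝟙 (Literature.AlgebraicGeometry.Motives.projectiveSpace n k).left) (Set.range ι) E₀ →
          E₀ = {y : (Literature.AlgebraicGeometry.Motives.projectiveSpace n k).left |
            ℓ ∈ (y : ProjectiveSpectrum (MvPolynomial.homogeneousSubmodule (Fin (n + 1)) k)).asHomogeneousIdeal} →
          ReachEquinodalPlanarNose₂ k n ℓ (Set.range ι) F₉ β T₉ E₉ → Q F₉ β T₉ E₉) → ∃ E' : Set F', Q F' ρ' T' E') ∧
      Literature.AlgebraicGeometry.Resolution.Scheme.IsRegular (AlgebraicGeometry.Scheme.IdealSheafData.vanishingIdeal (⟨closure T', isClosed_closure⟩ : TopologicalSpace.Closeds F')).subscheme)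


/-- blob₂ ⇒ blob₃ᵉ v2 (the extra closure hypothesis is not used). [OURS · pure logic] -/
theorem noseHypHostedNestEquinodalBTriplePrime₂_of_hostedNest₂ (k : Type) [Field k] [IsAlgClosed k] (n : ℕ) (H : AlgebraicGeometry.Scheme.{0})
    (ι : H ⟶ (Literature.AlgebraicGeometry.Motives.projectiveSpace n k).left) (h : NoseHypHostedNestBTriplePrime₂ k n H ι) :
    NoseHypHostedNestEquinodalBTriplePrime₂ k n H ι := by
  obtain ⟨E₀, hE₀, F', ρ', T', hQ, hreg⟩ := h
  exact ⟨E₀, hE₀, F', ρ', T', fun Q hQ0 hpt hround hreach _ => hQ Q hQ0 hpt hround hreach, hreg⟩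

/-- Contrapositive, as the REPLACE cut (41st) consumes it: `¬ blob₃ᵉ v2 → ¬ blob₂`. [OURS · pure logic] -/
theorem not_noseHypHostedNestBTriplePrime₂_of_not_hostedNestEquinodal₂ (k : Type) [Field k] [IsAlgClosed k] (n : ℕ)
    (H : AlgebraicGeometry.Scheme.{0}) (ι : H ⟶ (Literature.AlgebraicGeometry.Motives.projectiveSpace n k).left)
    (h : ¬ NoseHypHostedNestEquinodalBTriplePrime₂ k n H ι) : ¬ NoseHypHostedNestBTriplePrime₂ k n H ι :=
  fun h' => h (noseHypHostedNestEquinodalBTriplePrime₂_of_hostedNest₂ k n H ι h')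

/-- … and `¬ blob₃ᵉ v2 → ¬ NoseHypPointsFirstBTriplePrime`. [OURS · pure logic] -/
theorem not_noseHypPointsFirstBTriplePrime_of_not_hostedNestEquinodal₂ (k : Type) [Field k] [IsAlgClosed k] (n : ℕ)
    (H : AlgebraicGeometry.Scheme.{0}) (ι : H ⟶ (Literature.AlgebraicGeometry.Motives.projectiveSpace n k).left)
    (h : ¬ NoseHypHostedNestEquinodalBTriplePrime₂ k n H ι) : ¬ NoseHypPointsFirstBTriplePrime k n H ι :=
  not_noseHypPointsFirstBTriplePrime_of_not_hostedNest₂ k n H ι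
    (not_noseHypHostedNestBTriplePrime₂_of_not_hostedNestEquinodal₂ k n H ι h)

/-- A motive closed under door v1 is closed under door v2 (v2's inner clauses ask more of the inner motive, its end gives more): every
`ReachEquinodalPlanarNose₂` move IS a `ReachEquinodalPlanarNose` move.  [OURS · pure logic] -/
theorem reachEquinodalPlanarNose_of_reachEquinodalPlanarNose₂ (k : Type) [Field k] (n : ℕ) (ℓ : MvPolynomial (Fin (n + 1)) k)
    (T₁ : Set (Literature.AlgebraicGeometry.Motives.projectiveSpace n k).left) (F₉ : Scheme.{0}) (β : F₉ ⟶ (Literature.AlgebraicGeometry.Motives.projectiveSpace n k).left) (T₉ E₉ : Set F₉)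
    (h : ReachEquinodalPlanarNose₂ k n ℓ T₁ F₉ β T₉ E₉) : ReachEquinodalPlanarNose k n ℓ T₁ F₉ β T₉ E₉ := by
  obtain ⟨hE₉, Z, hZ, hZT, hTZ, hZinf, hZPi, hZirr, hZdim, hGreg, hEreg, hEdim, hcert, F₂, υ, T₂, E₂, Z₂, hZ₂, hmot, -, -, -, -,
    hZ₂reg, F₃, υ', hυ', γ', E', Es', Ns', K', htail, hβ⟩ := h
  refine ⟨hE₉, Z, hZ, hZT, hTZ, hZinf, hZPi, hZirr, hZdim, hGreg, hEreg, hEdim, hcert, F₂, υ, T₂, E₂, Z₂, hZ₂, ?_, hZ₂reg, F₃, υ', hυ',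
    γ', E', Es', Ns', K', htail, hβ⟩
  intro R hR0 hpt hrd
  -- run v2's inner motive with the auxiliary conjunct `W ⊆ T` … no: v1's closure hypotheses are STRONGER demands (fewer binders), so they imply v2's
  exact hmot R hR0 (fun G G' γ T E W hW w υ₁ hy hRG _ hw hG hE hυ₁ => hpt G G' γ T E W hW w υ₁ hy hRG hw hG hE hυ₁)
    (fun G G' γ T E W Z' hZ' υ' hRG _ _ hZ'E hZ'T hTZ' hZ'reg hEreg' hunobs hdim hυ' => hrd G G' γ T E W Z' hZ' υ' hRG hZ'E hZ'T hTZ' hZ'reg hEreg' hunobs hdim hυ')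

/-- Hence blob₃ᵉ v2 ⇒ blob₃ᵉ v1 (a motive closed under v1-moves is closed under v2-moves); so `¬ v1 ⇒ ¬ v2` and the 41st cut with v2
removes no less honestly than v1 would. [OURS · pure logic] -/
theorem noseHypHostedNestEquinodalBTriplePrime_of_equinodal₂ (k : Type) [Field k] [IsAlgClosed k] (n : ℕ) (H : AlgebraicGeometry.Scheme.{0})
    (ι : H ⟶ (Literature.AlgebraicGeometry.Motives.projectiveSpace n k).left) (h : NoseHypHostedNestEquinodalBTriplePrime₂ k n H ι) :
    NoseHypHostedNestEquinodalBTriplePrime k n H ι := by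
  obtain ⟨E₀, hE₀, F', ρ', T', hQ, hreg⟩ := h
  refine ⟨E₀, hE₀, F', ρ', T', fun Q hQ0 hpt hround hreach heq => hQ Q hQ0 hpt hround hreach ?_, hreg⟩
  intro ℓ F₉ β T₉ E₉ hQ₀ hE hR
  exact heq ℓ F₉ β T₉ E₉ hQ₀ hE (reachEquinodalPlanarNose_of_reachEquinodalPlanarNose₂ k n ℓ _ F₉ β T₉ E₉ hR)

end Summit.ResolutionOfSingularities.ResolutionOfSingularities.Cruxes.EquisingularLiftNat.Sections

end
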